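import Literature.NumberTheory.Sieve.MaynardNFWeights
import Literature.NumberTheory.LFunctions.MertensPrimeIdeals
import Literature.NumberTheory.Sieve.SquarefreeIdealSums
import HarnessLib

/-!
# The Maynard–Tao sieve over `𝓞_K`: the sizes of the parameters `D₀(N)`, `𝔴(N)`

Topic `Literature/NumberTheory/Sieve`. The bookkeeping of §2.2 of A. Castillo, C. Hall, R. J. Lemke
Oliver, P. Pollack, L. Thompson, *Bounded gaps between primes in number fields and function fields*,
Proc. AMS 143 (2015) = arXiv:1403.5808 ("`𝔴 := ∏_{|𝔭|<D₀} 𝔭` for some `D₀` tending slowly to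
infinity with `N`, say `D₀ = log log log N`"), for the parameters of `MaynardNFSieve`-type files:
`D₀(N) = log log log N`, `𝔴(N) = ∏_{N𝔭 ≤ D₀(N)} 𝔭`. Everything in this file is PROVED; it is the
number-field analogue of the parameter lemmas of the tree's `MaynardSieveLemma51.lean`.

* `paramD0`, `primesLE'`, `paramW` (copies of the parameter definitions, kept here so that this
  file does not depend on the `S₂` chain), `squarefree_paramW`, `paramW_ne_bot`,
  `dvd_paramW_of_absNorm_le`, `toFinset_normalizedFactors_paramW`;
* `tendsto_paramD0_atTop` (`D₀ → ∞`), `log_absNorm_paramW_eq` (`log N𝔴 = θ_K(D₀)`),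
  `log_absNorm_paramW_le` (`log N𝔴 ≤ C D₀`, Chebyshev for `K`),
  `idealTotient_paramW_div_eq` (`φ(𝔴)/N𝔴 = ∏_{N𝔭 ≤ D₀}(1 − 1/N𝔭)`),
  `one_div_le_idealTotient_paramW_div` (`φ(𝔴)/N𝔴 ≥ 1/(C log D₀)`, crude Mertens),
  `eventually_dvd_paramW_of_mem` (a fixed nonzero prime divides `𝔴(N)` for large `N`; used for
  "`P ∣ hᵢ − hⱼ ⇒ P ∣ 𝔴`" and "`N𝔭 = 2 ⇒ 𝔭 ∣ 𝔴`").

## References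

* Castillo–Hall–Lemke Oliver–Pollack–Thompson, arXiv:1403.5808, §2.2 (the parameters `D₀`, `𝔴`).
  [CastilloEtAl2015]
-/

noncomputable section

open Finset Filter Topology UniqueFactorizationMonoid NumberField IsDedekindDomain
open scoped NumberField Classical

namespace Literature.NumberTheory.Sieve.MaynardNF

open Literature.NumberTheory.LFunctions Literature.NumberTheory.LFunctions.NumberField
  Literature.NumberTheory.Sieve.SquarefreeIdeal

variable {K : Type*} [Field K] [NumberField K]

/-! ### The parameters -/

/-- `D₀(N) = log log log N`. [cite: CastilloEtAl2015, §2.2 (D₀ = log log log N)] -/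
def paramD0 (N : ℝ) : ℝ := Real.log (Real.log (Real.log N))

variable (K) in
/-- The prime ideals of norm `≤ D`, as height-one primes. [folklore] -/
def primesLE' (D : ℝ) : Finset (HeightOneSpectrum (𝓞 K)) :=
  (finite_primeIdealsLE K D).toFinset.preimage HeightOneSpectrum.asIdeal
    (fun _ _ _ _ h => HeightOneSpectrum.ext h)

/-- Membership in `primesLE'`. [folklore] -/
theorem mem_primesLE' {D : ℝ} {v : HeightOneSpectrum (𝓞 K)} :
    v ∈ primesLE' K D ↔ (Ideal.absNorm v.asIdeal : ℝ) ≤ D := by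
  rw [primesLE', Finset.mem_preimage, Set.Finite.mem_toFinset]
  exact ⟨fun h => h.2.2, fun h => ⟨v.isPrime, v.ne_bot, h⟩⟩

/-- `primesLE'` maps onto the finset of prime ideals of norm `≤ D`. [folklore] -/
theorem image_primesLE' (D : ℝ) :
    (primesLE' K D).image HeightOneSpectrum.asIdeal = (finite_primeIdealsLE K D).toFinset := by
  ext P
  rw [Finset.mem_image, Set.Finite.mem_toFinset]
  constructor
  · rintro ⟨v, hv, rfl⟩
    exact ⟨v.isPrime, v.ne_bot, mem_primesLE'.1 hv⟩
  · rintro ⟨hP, hP0, hle⟩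
    exact ⟨⟨P, hP, hP0⟩, mem_primesLE'.2 hle, rfl⟩

variable (K) in
/-- `𝔴(N) = ∏_{N𝔭 ≤ D₀(N)} 𝔭`. [cite: CastilloEtAl2015, §2.2 (𝔴 := ∏_{|𝔭|<D₀} 𝔭)] -/
def paramW (N : ℝ) : Ideal (𝓞 K) := prodIdeal (primesLE' K (paramD0 N))

/-- `𝔴(N)` is squarefree. [folklore] -/
theorem squarefree_paramW (N : ℝ) : Squarefree (paramW K N) := by
  rw [paramW, squarefree_iff_nodup_normalizedFactors (prodIdeal_ne_zero _), normalizedFactors_prodIdeal]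
  exact Multiset.Nodup.map (fun v w h => HeightOneSpectrum.ext h) (Finset.nodup _)

/-- `𝔴(N) ≠ 0`. [folklore] -/
theorem paramW_ne_bot (N : ℝ) : paramW K N ≠ ⊥ := fun h =>
  (squarefree_paramW (K := K) N).ne_zero (h.trans Ideal.zero_eq_bot.symm)

/-- Every nonzero prime ideal of norm `≤ D₀(N)` divides `𝔴(N)`. [cite: CastilloEtAl2015, §2.2] -/
theorem dvd_paramW_of_absNorm_le {N : ℝ} {P : Ideal (𝓞 K)} (hP : P.IsPrime) (hP0 : P ≠ ⊥)
    (hle : (Ideal.absNorm P : ℝ) ≤ paramD0 N) : P ∣ paramW K N := by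
  have hv : (⟨P, hP, hP0⟩ : HeightOneSpectrum (𝓞 K)) ∈ primesLE' K (paramD0 N) := mem_primesLE'.2 hle
  have h := dvd_prodIdeal_iff.2 hv
  exact h

/-- `Prime`-flavoured form. [cite: CastilloEtAl2015, §2.2] -/
theorem dvd_paramW_of_prime_of_absNorm_le {N : ℝ} {P : Ideal (𝓞 K)} (hP : Prime P)
    (hle : (Ideal.absNorm P : ℝ) ≤ paramD0 N) : P ∣ paramW K N :=
  dvd_paramW_of_absNorm_le (Ideal.isPrime_of_prime hP) hP.ne_zero hle

/-- The distinct prime factors of `𝔴(N)` are the prime ideals of norm `≤ D₀(N)`. [folklore] -/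
theorem toFinset_normalizedFactors_paramW (N : ℝ) :
    (normalizedFactors (paramW K N)).toFinset = (finite_primeIdealsLE K (paramD0 N)).toFinset := by
  rw [paramW, normalizedFactors_prodIdeal, ← image_primesLE']
  ext P
  simp [Finset.mem_image]

/-! ### `D₀ → ∞` and the size of `𝔴` -/

/-- `D₀(N) → ∞`. [cite: CastilloEtAl2015, §2.2 (D₀ tending slowly to infinity)] -/
theorem tendsto_paramD0_atTop : Tendsto paramD0 atTop atTop :=
  Real.tendsto_log_atTop.comp (Real.tendsto_log_atTop.comp Real.tendsto_log_atTop)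

/-- `log N𝔴(N) = θ_K(D₀(N))` (for `D₀(N) ≥ 0`). [folklore] -/
theorem log_absNorm_paramW_eq {N : ℝ} (hD : 0 ≤ paramD0 N) :
    Real.log (Ideal.absNorm (paramW K N) : ℝ) = chebyshevThetaIdeal K (paramD0 N) := by
  rw [chebyshevThetaIdeal_eq_sum_primeIdealsLE K hD, paramW, prodIdeal, map_prod, Nat.cast_prod,
    Real.log_prod (s := primesLE' K (paramD0 N)) (fun v _ => by
      exact_mod_cast (Ideal.absNorm_eq_zero_iff.not.2 v.ne_bot)),
    ← image_primesLE', Finset.sum_image fun v _ w _ h => HeightOneSpectrum.ext h]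

/-- **`log N𝔴(N) ≤ C D₀(N)`** for `D₀(N) ≥ 2` (Chebyshev's bound for `K`: `θ_K(x) ≤ x + Cx/log x`,
`MertensPrimeIdeals.abs_chebyshevThetaIdeal_sub_self_le_logPow`). [cite: CastilloEtAl2015, §2.2] -/
theorem log_absNorm_paramW_le :
    ∃ C : ℝ, 0 ≤ C ∧ ∀ N : ℝ, 2 ≤ paramD0 N → Real.log (Ideal.absNorm (paramW K N) : ℝ) ≤ C * paramD0 N := by
  obtain ⟨C, hC⟩ := abs_chebyshevThetaIdeal_sub_self_le_logPow K 0
  refine ⟨1 + |C|, by positivity, fun N hD => ?_⟩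
  have hD0 : 0 ≤ paramD0 N := by linarith
  rw [log_absNorm_paramW_eq hD0]
  have h := hC (paramD0 N) hD
  rw [Real.rpow_zero, div_one] at h
  have h2 : chebyshevThetaIdeal K (paramD0 N) ≤ paramD0 N + |C| * paramD0 N := by
    have := (abs_le.1 h).2
    nlinarith [le_abs_self C, abs_nonneg C]
  linarith

/-! ### `φ(𝔴)/N𝔴` -/

/-- `φ(𝔴(N))/N𝔴(N) = ∏_{N𝔭 ≤ D₀(N)} (1 − 1/N𝔭)`. [folklore] -/
theorem idealTotient_paramW_div_eq (N : ℝ) :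
    idealTotient K (paramW K N) / (Ideal.absNorm (paramW K N) : ℝ) =
      ∏ P ∈ (finite_primeIdealsLE K (paramD0 N)).toFinset, (1 - 1 / (Ideal.absNorm P : ℝ)) := by
  have hn : (0 : ℝ) < Ideal.absNorm (paramW K N) := by
    exact_mod_cast Nat.pos_of_ne_zero (by rw [Ne, Ideal.absNorm_eq_zero_iff]; exact paramW_ne_bot N)
  rw [idealTotient, toFinset_normalizedFactors_paramW]
  field_simp

/-- **`φ(𝔴(N))/N𝔴(N) ≥ 1/(C log D₀(N))`** for `D₀(N) ≥ 2` (crude Mertens over `K`: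
`∏_{N𝔭 ≤ x}(1 + 1/(N𝔭 − 1)) ≤ C log x`, `MertensPrimeIdeals.prod_one_add_div_absNorm_sub_one_le`, and
`(1 − 1/N𝔭)⁻¹ = 1 + 1/(N𝔭 − 1)`). [cite: CastilloEtAl2015, §2.2] -/
theorem one_div_le_idealTotient_paramW_div :
    ∃ C : ℝ, 0 < C ∧ ∀ N : ℝ, 2 ≤ paramD0 N →
      1 / (C * Real.log (paramD0 N)) ≤ idealTotient K (paramW K N) / (Ideal.absNorm (paramW K N) : ℝ) := by
  obtain ⟨C, hC⟩ := prod_one_add_div_absNorm_sub_one_le K (a := 1) zero_le_one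
  -- `C > 0`: the product at `x = 2` is `≥ 1`
  have hC0 : 0 < C := by
    have h := hC 2 le_rfl
    have h1 : (1 : ℝ) ≤ ∏ P ∈ (finite_primeIdealsLE K 2).toFinset, (1 + 1 / ((Ideal.absNorm P : ℝ) - 1)) := by
      calc (1 : ℝ) = ∏ _P ∈ (finite_primeIdealsLE K 2).toFinset, (1 : ℝ) := by simp
        _ ≤ _ := by
          refine Finset.prod_le_prod (fun _ _ => zero_le_one) fun P hP => ?_
          rw [Set.Finite.mem_toFinset] at hP
          have h2 : (2 : ℝ) ≤ Ideal.absNorm P := by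
            exact_mod_cast two_le_absNorm_of_prime (Ideal.prime_of_isPrime hP.2.1 hP.1)
          have : 0 ≤ 1 / ((Ideal.absNorm P : ℝ) - 1) := by apply div_nonneg zero_le_one; linarith
          linarith
    rw [Real.rpow_one] at h
    have hlog : 0 < Real.log 2 := Real.log_pos (by norm_num)
    nlinarith
  refine ⟨C, hC0, fun N hD => ?_⟩
  have h := hC (paramD0 N) hD
  rw [Real.rpow_one] at h
  have hlog : 0 < Real.log (paramD0 N) := Real.log_pos (by linarith)
  rw [idealTotient_paramW_div_eq]
  set T := (finite_primeIdealsLE K (paramD0 N)).toFinset with hT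
  have hprod : ∏ P ∈ T, (1 - 1 / (Ideal.absNorm P : ℝ)) =
      1 / ∏ P ∈ T, (1 + 1 / ((Ideal.absNorm P : ℝ) - 1)) := by
    rw [one_div, ← Finset.prod_inv_distrib]
    refine Finset.prod_congr rfl fun P hP => ?_
    rw [hT, Set.Finite.mem_toFinset] at hP
    have h2 : (2 : ℝ) ≤ Ideal.absNorm P := by
      exact_mod_cast two_le_absNorm_of_prime (Ideal.prime_of_isPrime hP.2.1 hP.1)
    have h1 : (Ideal.absNorm P : ℝ) - 1 ≠ 0 := by linarith
    have h3 : (Ideal.absNorm P : ℝ) ≠ 0 := by linarith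
    rw [one_sub_div h3, one_add_div h1, inv_div]
    congr 1
    ring
  rw [hprod]
  have hpos : 0 < ∏ P ∈ T, (1 + 1 / ((Ideal.absNorm P : ℝ) - 1)) := by
    refine Finset.prod_pos fun P hP => ?_
    rw [hT, Set.Finite.mem_toFinset] at hP
    have h2 : (2 : ℝ) ≤ Ideal.absNorm P := by
      exact_mod_cast two_le_absNorm_of_prime (Ideal.prime_of_isPrime hP.2.1 hP.1)
    have : 0 ≤ 1 / ((Ideal.absNorm P : ℝ) - 1) := by apply div_nonneg zero_le_one; linarith
    linarith
  exact one_div_le_one_div_of_le hpos h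

/-! ### A fixed prime divides `𝔴(N)` eventually -/

/-- For every bound `B` the primes of norm `≤ B` divide `𝔴(N)` for all large `N` (`D₀ → ∞`); in
particular every prime ideal containing a fixed nonzero element (such as `hᵢ − hⱼ`) and every prime of
norm `2`. [cite: CastilloEtAl2015, §2.2] -/
theorem eventually_dvd_paramW_of_absNorm_le (B : ℝ) :
    ∀ᶠ N : ℝ in atTop, ∀ P : Ideal (𝓞 K), Prime P → (Ideal.absNorm P : ℝ) ≤ B → P ∣ paramW K N := by
  filter_upwards [tendsto_paramD0_atTop.eventually_ge_atTop B] with N hN P hP hle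
  exact dvd_paramW_of_prime_of_absNorm_le hP (hle.trans hN)

/-- A prime ideal containing a fixed nonzero `a` has norm `≤ |N(a)|`, hence divides `𝔴(N)` for all
large `N`. [cite: CastilloEtAl2015, §2.2 (the primes dividing hᵢ − hⱼ divide 𝔴)] -/
theorem eventually_dvd_paramW_of_mem {a : 𝓞 K} (ha : a ≠ 0) :
    ∀ᶠ N : ℝ in atTop, ∀ P : Ideal (𝓞 K), P.IsPrime → a ∈ P → P ∣ paramW K N := by
  filter_upwards [eventually_dvd_paramW_of_absNorm_le (K := K)
    (Ideal.absNorm (Ideal.span ({a} : Set (𝓞 K))) : ℝ)] with N hN P hP haP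
  by_cases hP0 : P = ⊥
  · subst hP0
    exact absurd (by simpa using haP) ha
  refine hN P (Ideal.prime_of_isPrime hP0 hP) ?_
  have hdvd : Ideal.absNorm P ∣ Ideal.absNorm (Ideal.span ({a} : Set (𝓞 K))) :=
    Ideal.absNorm_dvd_absNorm_of_le ((Ideal.span_singleton_le_iff_mem _).2 haP)
  have hne : Ideal.absNorm (Ideal.span ({a} : Set (𝓞 K))) ≠ 0 := by
    rw [Ne, Ideal.absNorm_eq_zero_iff, Ideal.span_singleton_eq_bot]; exact ha
  exact_mod_cast Nat.le_of_dvd (Nat.pos_of_ne_zero hne) hdvd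

end Literature.NumberTheory.Sieve.MaynardNF
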